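import Summits.AtomisticToContinuum.Crystallization.Theorems.FrustratedLawDichotomyStrainedPatchHomEntrySemanticQuotColumn

/-!
# Manifest-list plumbing, GENERIC in the verdict (both currencies `semOKH` / `semOKHQ`, the fcc `semOKF`, any Boolean cell verdict)

decomp-a2c hand-2 g40 — structural share for the crux `AperiodicFrustratedLawGap` (stmt-AtomisticToContinuum-27623; `(H) HomFloor`), DEF-FREE glue for the
PRODUCTION MANIFESTS of the draw of record (hand-1 g41 R5 driver on the quarter root `rootCHQ/rootWHQ`, lens-5 NODE 88).  The root consumers
(`…HomCutTree.semOKH_root_of_manifest`, `…HomExteriorCellBacked.semOKH_root_of_colManifest7`, `…HomEntrySemanticQuotColumn.semOKHQ_root_of_colManifest5Q`,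
`…HomFloorF6pT26Quot.aperiodicFrustratedLawGap_of_entryTree6RBKP4_colManifest5Q_…`) all read the landed cell facts as ONE hypothesis
`hL : ∀ b ∈ L, v b.1 b.2 = true`; `…HomCutTree` §4 typed the list plumbing (`semFacts_nil/cons/append`) for `v = semOKH μ` only.  Here it is stated once
for EVERY verdict `v : κ → κ → Bool` (so no further twins are needed), with the level transport for the three semantic currencies:

* §1 `facts_nil`, `facts_cons`, `facts_singleton`, `facts_append`, `facts_of_imp` (change of verdict along an implication, e.g. `semOKH ↦ semOKHQ` on positive
  cells via `semOKHQ_of_semOKH_pos`, or a kernel verdict `↦` its semantic meaning), `facts_map_of` (facts for a mapped list).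
* §2 level transport of a whole manifest list: `semFactsQ_mono_level`, `semFactsH_mono_level`, `semFactsF_mono_level` (cells certified at a HIGHER level
  `μ` serve a draw at any `μ' ≤ μ` — e.g. the `μ₇₈`-cells of record at `μ₇₄`).
* §3 the `semOKHQ` twins by name (`semFactsQ_nil/cons/append`) for generated assembly files, and `semFactsQ_of_semFactsH_root`-free conversion of a list of
  POSITIVE-quadrant `semOKH` cells (`semFactsQ_of_pos`).

NO definitions; 0 sorry; standard axioms.  `--supports stmt-AtomisticToContinuum-27623`.  [formal bookkeeping throughout]
-/

namespace Summit.AtomisticToContinuum.Crystallization.Theorems.FrustratedLawDichotomyStrainedPatchHomCutTreeFacts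

open Summit.AtomisticToContinuum.Crystallization.Theorems.FrustratedLawDichotomyStrainedPatchHomEntryLeafHT (semOKH semOKF semOKF_mono_level
  semOKH_mono_level)
open Summit.AtomisticToContinuum.Crystallization.Theorems.FrustratedLawDichotomyStrainedPatchHomEntrySemanticQuot (semOKHQ semOKHQ_mono_level
  semOKHQ_of_semOKH_pos)

/-! ## §1. Generic list plumbing for `∀ b ∈ L, v b.1 b.2 = true` -/

section Generic

variable {κ : Type*}

/-- The empty manifest list is certified, for any verdict. [formal bookkeeping] -/
theorem facts_nil (v : κ → κ → Bool) : ∀ b ∈ ([] : List (κ × κ)), v b.1 b.2 = true := by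
  simp

/-- Cons a landed fact onto a certified manifest list, any verdict. [formal bookkeeping] -/
theorem facts_cons {v : κ → κ → Bool} {c w : κ} {L : List (κ × κ)} (hb : v c w = true) (hL : ∀ b ∈ L, v b.1 b.2 = true) :
    ∀ b ∈ ((c, w) :: L), v b.1 b.2 = true := by
  intro b hb'
  rcases List.mem_cons.1 hb' with rfl | h
  · exact hb
  · exact hL b h

/-- A one-cell manifest list. [formal bookkeeping] -/
theorem facts_singleton {v : κ → κ → Bool} {c w : κ} (hb : v c w = true) : ∀ b ∈ [(c, w)], v b.1 b.2 = true :=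
  facts_cons hb (facts_nil v)

/-- Appending two certified manifest lists, any verdict. [formal bookkeeping] -/
theorem facts_append {v : κ → κ → Bool} {L₁ L₂ : List (κ × κ)} (h₁ : ∀ b ∈ L₁, v b.1 b.2 = true) (h₂ : ∀ b ∈ L₂, v b.1 b.2 = true) :
    ∀ b ∈ L₁ ++ L₂, v b.1 b.2 = true := by
  intro b hb
  rcases List.mem_append.1 hb with h | h
  · exact h₁ b h
  · exact h₂ b h

/-- Heads and tails of a certified list. [formal bookkeeping] -/
theorem facts_head {v : κ → κ → Bool} {c w : κ} {L : List (κ × κ)} (h : ∀ b ∈ ((c, w) :: L), v b.1 b.2 = true) : v c w = true :=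
  h (c, w) (List.mem_cons_self)

/-- Heads and tails of a certified list. [formal bookkeeping] -/
theorem facts_tail {v : κ → κ → Bool} {c w : κ} {L : List (κ × κ)} (h : ∀ b ∈ ((c, w) :: L), v b.1 b.2 = true) :
    ∀ b ∈ L, v b.1 b.2 = true :=
  fun b hb => h b (List.mem_cons_of_mem _ hb)

/-- ★ **Change of verdict along an implication** (cellwise): if `v c w → v' c w` for every listed cell then a `v`-certified list is `v'`-certified —
e.g. kernel verdict `↦` semantic meaning, `semOKH μ ↦ semOKH μ'` (`μ' ≤ μ`), `semOKH ↦ semOKHQ` on positive cells. [formal bookkeeping] -/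
theorem facts_of_imp {v v' : κ → κ → Bool} {L : List (κ × κ)} (himp : ∀ b ∈ L, v b.1 b.2 = true → v' b.1 b.2 = true)
    (hL : ∀ b ∈ L, v b.1 b.2 = true) : ∀ b ∈ L, v' b.1 b.2 = true :=
  fun b hb => himp b hb (hL b hb)

/-- Uniform change of verdict. [formal bookkeeping] -/
theorem facts_of_imp' {v v' : κ → κ → Bool} {L : List (κ × κ)} (himp : ∀ c w, v c w = true → v' c w = true)
    (hL : ∀ b ∈ L, v b.1 b.2 = true) : ∀ b ∈ L, v' b.1 b.2 = true :=
  facts_of_imp (fun b _ h => himp b.1 b.2 h) hL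

/-- A list ALL of whose cells pass a (kernel-decidable) verdict `v` is `v`-certified — the `List.all` form a generated file can close by `decide`.
[formal bookkeeping] -/
theorem facts_of_all {v : κ → κ → Bool} {L : List (κ × κ)} (h : (L.all fun b => v b.1 b.2) = true) : ∀ b ∈ L, v b.1 b.2 = true := by
  intro b hb
  exact List.all_eq_true.1 h b hb

/-- Conversely. [formal bookkeeping] -/
theorem all_of_facts {v : κ → κ → Bool} {L : List (κ × κ)} (h : ∀ b ∈ L, v b.1 b.2 = true) : (L.all fun b => v b.1 b.2) = true :=
  List.all_eq_true.2 fun b hb => h b hb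

/-- ★ Kernel verdict + soundness ⟹ semantic facts for the whole list: `L.all kernel = true` (ONE `decide`) and `kernel ⟹ v` give `∀ b ∈ L, v …`.
[formal bookkeeping] -/
theorem facts_of_all_sound {kernel v : κ → κ → Bool} {L : List (κ × κ)} (hsound : ∀ c w, kernel c w = true → v c w = true)
    (h : (L.all fun b => kernel b.1 b.2) = true) : ∀ b ∈ L, v b.1 b.2 = true :=
  facts_of_imp' hsound (facts_of_all h)

end Generic

/-! ## §2. Level transport of whole manifest lists (three semantic currencies) -/

/-- A `semOKHQ`-list certified at level `μ` is certified at every `μ' ≤ μ`. [formal bookkeeping: `semOKHQ_mono_level`] -/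
theorem semFactsQ_mono_level {μ μ' : ℤ} (hle : μ' ≤ μ) {L : List (((Fin 3 × Fin 3) ⊕ Fin 3 → ℤ) × ((Fin 3 × Fin 3) ⊕ Fin 3 → ℤ))}
    (hL : ∀ b ∈ L, semOKHQ μ b.1 b.2 = true) : ∀ b ∈ L, semOKHQ μ' b.1 b.2 = true :=
  facts_of_imp' (fun _ _ h => semOKHQ_mono_level hle h) hL

/-- A `semOKH`-list certified at level `μ` is certified at every `μ' ≤ μ`. [formal bookkeeping: `semOKH_mono_level`] -/
theorem semFactsH_mono_level {μ μ' : ℤ} (hle : μ' ≤ μ) {L : List (((Fin 3 × Fin 3) ⊕ Fin 3 → ℤ) × ((Fin 3 × Fin 3) ⊕ Fin 3 → ℤ))}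
    (hL : ∀ b ∈ L, semOKH μ b.1 b.2 = true) : ∀ b ∈ L, semOKH μ' b.1 b.2 = true :=
  facts_of_imp' (fun _ _ h => semOKH_mono_level hle h) hL

/-- A `semOKF`-list certified at level `μ` is certified at every `μ' ≤ μ`. [formal bookkeeping: `semOKF_mono_level`] -/
theorem semFactsF_mono_level {μ μ' : ℤ} (hle : μ' ≤ μ) {L : List ((Fin 3 × Fin 3 → ℤ) × (Fin 3 × Fin 3 → ℤ))}
    (hL : ∀ b ∈ L, semOKF μ b.1 b.2 = true) : ∀ b ∈ L, semOKF μ' b.1 b.2 = true :=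
  facts_of_imp' (fun _ _ h => semOKF_mono_level hle h) hL

/-- Mixed levels: append a list certified at `μ₁` and one at `μ₂` into one list at any common lower level `μ`. [formal bookkeeping] -/
theorem semFactsQ_append_levels {μ μ₁ μ₂ : ℤ} (h₁le : μ ≤ μ₁) (h₂le : μ ≤ μ₂)
    {L₁ L₂ : List (((Fin 3 × Fin 3) ⊕ Fin 3 → ℤ) × ((Fin 3 × Fin 3) ⊕ Fin 3 → ℤ))}
    (h₁ : ∀ b ∈ L₁, semOKHQ μ₁ b.1 b.2 = true) (h₂ : ∀ b ∈ L₂, semOKHQ μ₂ b.1 b.2 = true) : ∀ b ∈ L₁ ++ L₂, semOKHQ μ b.1 b.2 = true :=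
  facts_append (semFactsQ_mono_level h₁le h₁) (semFactsQ_mono_level h₂le h₂)

/-! ## §3. The quotient-currency twins by name, and positive-cell conversion of a whole list -/

/-- `semOKHQ` twin of `…HomCutTree.semFacts_nil`. [formal bookkeeping] -/
theorem semFactsQ_nil {μ : ℤ} : ∀ b ∈ ([] : List (((Fin 3 × Fin 3) ⊕ Fin 3 → ℤ) × ((Fin 3 × Fin 3) ⊕ Fin 3 → ℤ))), semOKHQ μ b.1 b.2 = true :=
  facts_nil (semOKHQ μ)

/-- `semOKHQ` twin of `…HomCutTree.semFacts_cons`. [formal bookkeeping] -/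
theorem semFactsQ_cons {μ : ℤ} {c w : (Fin 3 × Fin 3) ⊕ Fin 3 → ℤ} {L : List (((Fin 3 × Fin 3) ⊕ Fin 3 → ℤ) × ((Fin 3 × Fin 3) ⊕ Fin 3 → ℤ))}
    (hb : semOKHQ μ c w = true) (hL : ∀ b ∈ L, semOKHQ μ b.1 b.2 = true) : ∀ b ∈ ((c, w) :: L), semOKHQ μ b.1 b.2 = true :=
  facts_cons hb hL

/-- `semOKHQ` twin of `…HomCutTree.semFacts_append`. [formal bookkeeping] -/
theorem semFactsQ_append {μ : ℤ} {L₁ L₂ : List (((Fin 3 × Fin 3) ⊕ Fin 3 → ℤ) × ((Fin 3 × Fin 3) ⊕ Fin 3 → ℤ))}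
    (h₁ : ∀ b ∈ L₁, semOKHQ μ b.1 b.2 = true) (h₂ : ∀ b ∈ L₂, semOKHQ μ b.1 b.2 = true) : ∀ b ∈ L₁ ++ L₂, semOKHQ μ b.1 b.2 = true :=
  facts_append h₁ h₂

/-- ★ **A whole list of landed `semOKH` cells lying in the positive quadrant `{ξ₀ ≥ 0, ξ₂ ≥ 0}`** (checked cellwise by the kernel: `c₀ − w₀ ≥ 0 ∧ c₂ − w₂ ≥ 0`
for every entry, ONE `decide`) **is a `semOKHQ` list** — `semOKHQ_of_semOKH_pos` mapped over the list. [formal bookkeeping] -/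
theorem semFactsQ_of_pos {μ : ℤ} {L : List (((Fin 3 × Fin 3) ⊕ Fin 3 → ℤ) × ((Fin 3 × Fin 3) ⊕ Fin 3 → ℤ))}
    (hpos : (L.all fun b => decide (0 ≤ b.1 (Sum.inr 0) - b.2 (Sum.inr 0)) && decide (0 ≤ b.1 (Sum.inr 2) - b.2 (Sum.inr 2))) = true)
    (hL : ∀ b ∈ L, semOKH μ b.1 b.2 = true) : ∀ b ∈ L, semOKHQ μ b.1 b.2 = true := by
  intro b hb
  have h := List.all_eq_true.1 hpos b hb
  simp only [Bool.and_eq_true, decide_eq_true_eq] at h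
  exact semOKHQ_of_semOKH_pos h.1 h.2 (hL b hb)

end Summit.AtomisticToContinuum.Crystallization.Theorems.FrustratedLawDichotomyStrainedPatchHomCutTreeFacts
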